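import Summits.CriticalPhenomena.PercolationContinuityZ3.Theorems.Transplant.GrigorchukPowerNcHaraSladeLaceNormLemmas
import HarnessLib

/-!
# W4 — the `k`-FREE lace-norm bound for coordinate-exchangeable kernels (refuter note N-p5g35-1): `ω_ξ(x) ≤ n(x)·Σ_i n_i(x)·Ω_i(ξ)` and
# `Σ_x |K(x)| ω_ξ(x) ≤ 4 κ₀(ξ) · Σ_x |K(x)| n(x)²`

Proof file (`--supports stmt-CriticalPhenomena-4575 --as helper`), lane `prim-bschramm`, seat `prim-bschramm-gen-1` gen 12 (GEN pen); follow-up to «…LaceNormLemmas» answering the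
refuter's located design note N-p5g35-1 (bus #9942): the factor `4k` of `omegaV_le_dist_sq` is sharp for general test vectors and fatal for S3a's `C/k` budget; what S3a
will consume is the ANISOTROPIC chain bound and its `k`-free consequence for kernels invariant under coordinate permutations (the lace kernel of `Cay(𝔊^k)` is, the
expansion being canonical and coordinate permutations being automorphisms fixing `1`).  builds on p205010 (kernel theorem, internal audit signed; external expert review
pending) — nothing here uses p205010.  Def-free; no instance, no notation, no sorry; stakes no claim, staffs nothing (S3a/S3b untouched).

NOTATION (spelled out in the statements, no defs): `n_i(x) := dist_{Cay(𝔊;a,b,c,d)}(1, x_i)` (`stdCay.dist 1 (x i)`), `n(x) := Σ_i n_i(x)` (the box-product length of `x`;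
it equals `dist_{Cay(𝔊^k)}(1, x)`, not needed here), `Ω_i(ξ) := Σ_{y∈{a,b,c,d}} ω_ξ(mulSingle i y)` (so `Σ_i Ω_i(ξ) = Σ_{s∈S_k} ω_ξ(s) = 4k κ₀(ξ)`, `sum_coord_omegaV_eq`).
* §1 chains coordinate by coordinate: `exists_chain_mulSingle`, `exists_chain_mul`, `exists_chain_of_support` ⟹ **`omegaV_le_aniso`**: `ω_ξ(x) ≤ n(x) · Σ_i n_i(x) Ω_i(ξ)` (3′).
* §2 **`tsum_abs_mul_omegaV_le_of_exchangeable`**: for `K` with `K(x ∘ σ) = K(x)` (all `σ ∈ Sym(Fin k)`) and `Σ_x |K(x)| n(x)² < ∞`: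
  `Σ_x |K(x)| ω_ξ(x) ≤ 4 κ₀(ξ) Σ_x |K(x)| n(x)²`; hence **`laceNormE_le_of_exchangeable`**: `laceNormE k K ≤ ‖K‖₁ ⊔ 4·Σ_x |K(x)| n(x)²` — no `k` (4′).
[cite: HeydenreichVanDerHofstad2017, §8.3 (1 − D̂(k); Prop. 8.3)] [cite: HaraSlade1990, §4 (lace-expansion norms)]
-/

noncomputable section

namespace Summit.CriticalPhenomena.PercolationContinuityZ3.Theorems.Transplant

namespace Grigorchuk

namespace NcHaraSlade

open SimpleGraph Finset Literature.Probability.Percolation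
open scoped ENNReal Classical

variable {k : ℕ}

/-! ## §1 Chains coordinate by coordinate; the anisotropic bound (3′) -/

/-- **One coordinate**: a chain `1 → mulSingle i g` of length `n = dist_𝔊(1, g)` whose steps are letters in coordinate `i`, so that
`Σ_steps ω_ξ ≤ n · Ω_i(ξ)` (a geodesic of `Cay(𝔊; a,b,c,d)` placed in coordinate `i`; «GrigorchukCayleyLabelRigidity» `stdCay_adj_iff`). [folklore] -/
theorem exists_chain_mulSingle (ξ : GPow k →₀ ℝ) (i : Fin k) (g : ↥grigorchukGroup) :
    ∃ v : ℕ → GPow k, v 0 = 1 ∧ v (stdCay.dist 1 g) = Pi.mulSingle i g ∧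
      ∑ j ∈ Finset.range (stdCay.dist 1 g), omegaV ξ ((v j)⁻¹ * v (j + 1)) ≤
        (stdCay.dist 1 g : ℝ) * ∑ y ∈ ({aG, bG, cG, dG} : Finset ↥grigorchukGroup), omegaV ξ (Pi.mulSingle i y) := by
  have hconn : stdCay.Connected := CayleyScaled.connected_mulCayley_of_closure _ closure_gens_finset
  obtain ⟨w, hw⟩ := hconn.exists_walk_length_eq_dist 1 g
  refine ⟨fun j => Pi.mulSingle i (w.getVert j), ?_, ?_, ?_⟩
  · show (Pi.mulSingle i (w.getVert 0) : GPow k) = 1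
    rw [Walk.getVert_zero, Pi.mulSingle_one]
  · show (Pi.mulSingle i (w.getVert (stdCay.dist 1 g)) : GPow k) = Pi.mulSingle i g
    rw [← hw, Walk.getVert_length]
  rw [← hw]
  have hstep : ∀ j ∈ Finset.range w.length, omegaV ξ ((Pi.mulSingle i (w.getVert j))⁻¹ * Pi.mulSingle i (w.getVert (j + 1))) ≤
      ∑ y ∈ ({aG, bG, cG, dG} : Finset ↥grigorchukGroup), omegaV ξ (Pi.mulSingle i y) := by
    intro j hj
    obtain ⟨y, hy⟩ := stdCay_adj_iff.1 (w.adj_getVert_succ (Finset.mem_range.1 hj))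
    rw [hy, ← Pi.mulSingle_inv, ← Pi.mulSingle_mul, inv_mul_cancel_left]
    exact Finset.single_le_sum (f := fun y => omegaV ξ (Pi.mulSingle i y)) (fun _ _ => omegaV_nonneg _ _) (mem_gens_iff.2 ⟨y, rfl⟩)
  refine (Finset.sum_le_sum hstep).trans ?_
  rw [Finset.sum_const, Finset.card_range, nsmul_eq_mul]

/-- **Concatenation of chains**: a chain `1 → x` of length `N₁` with step-sum `≤ B₁` and a chain `1 → z` of length `N₂` with step-sum `≤ B₂` give a chain `1 → x·z` of
length `N₁ + N₂` with step-sum `≤ B₁ + B₂` (translate the second by `x`; steps are left-invariant). [folklore] -/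
theorem exists_chain_mul (ξ : GPow k →₀ ℝ) {x z : GPow k} {N₁ N₂ : ℕ} {B₁ B₂ : ℝ}
    (h₁ : ∃ v : ℕ → GPow k, v 0 = 1 ∧ v N₁ = x ∧ ∑ j ∈ Finset.range N₁, omegaV ξ ((v j)⁻¹ * v (j + 1)) ≤ B₁)
    (h₂ : ∃ v : ℕ → GPow k, v 0 = 1 ∧ v N₂ = z ∧ ∑ j ∈ Finset.range N₂, omegaV ξ ((v j)⁻¹ * v (j + 1)) ≤ B₂) :
    ∃ v : ℕ → GPow k, v 0 = 1 ∧ v (N₁ + N₂) = x * z ∧ ∑ j ∈ Finset.range (N₁ + N₂), omegaV ξ ((v j)⁻¹ * v (j + 1)) ≤ B₁ + B₂ := by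
  obtain ⟨v₁, h10, h1N, h1s⟩ := h₁
  obtain ⟨v₂, h20, h2N, h2s⟩ := h₂
  set v : ℕ → GPow k := fun j => if j ≤ N₁ then v₁ j else x * v₂ (j - N₁) with hv
  have hvle : ∀ j, j ≤ N₁ → v j = v₁ j := fun j hj => by simp only [hv, if_pos hj]
  have hvge : ∀ j, v (N₁ + j) = x * v₂ j := by
    intro j
    rcases Nat.eq_zero_or_pos j with rfl | hj
    · rw [add_zero, hvle N₁ le_rfl, h1N, h20, mul_one]
    · simp only [hv, if_neg (show ¬ N₁ + j ≤ N₁ by omega), Nat.add_sub_cancel_left]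
  refine ⟨v, by rw [hvle 0 (Nat.zero_le _), h10], by rw [hvge N₂, h2N], ?_⟩
  rw [Finset.sum_range_add]
  refine add_le_add (le_of_eq_of_le (Finset.sum_congr rfl fun j hj => ?_) h1s) (le_of_eq_of_le (Finset.sum_congr rfl fun j _ => ?_) h2s)
  · have hj' := Finset.mem_range.1 hj
    rw [hvle j hj'.le, hvle (j + 1) hj']
  · rw [show N₁ + j + 1 = N₁ + (j + 1) from rfl, hvge j, hvge (j + 1), mul_inv_rev, mul_assoc, inv_mul_cancel_left]

/-- **Chains for elements supported on a set of coordinates** (induction on the support `T`): a chain `1 → x` of length `Σ_{i∈T} n_i(x)` with step-sum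
`≤ Σ_{i∈T} n_i(x) Ω_i(ξ)`. [folklore] -/
theorem exists_chain_of_support (ξ : GPow k →₀ ℝ) (T : Finset (Fin k)) :
    ∀ x : GPow k, (∀ i, i ∉ T → x i = 1) →
      ∃ v : ℕ → GPow k, v 0 = 1 ∧ v (∑ i ∈ T, stdCay.dist 1 (x i)) = x ∧
        ∑ j ∈ Finset.range (∑ i ∈ T, stdCay.dist 1 (x i)), omegaV ξ ((v j)⁻¹ * v (j + 1)) ≤
          ∑ i ∈ T, (stdCay.dist 1 (x i) : ℝ) * ∑ y ∈ ({aG, bG, cG, dG} : Finset ↥grigorchukGroup), omegaV ξ (Pi.mulSingle i y) := by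
  induction T using Finset.induction_on with
  | empty =>
    intro x hx
    have hx1 : x = 1 := funext fun i => hx i (Finset.notMem_empty i)
    subst hx1
    exact ⟨fun _ => 1, rfl, by simp, by simp⟩
  | insert i T hiT ih =>
    intro x hx
    set x' : GPow k := Function.update x i 1 with hx'
    have hx'T : ∀ j, j ∉ T → x' j = 1 := by
      intro j hj
      by_cases hji : j = i
      · rw [hji, hx', Function.update_self]
      · rw [hx', Function.update_of_ne hji]
        exact hx j (by rw [Finset.mem_insert]; exact not_or.2 ⟨hji, hj⟩)
    have hxeq : x' * Pi.mulSingle i (x i) = x := by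
      funext j
      by_cases hji : j = i
      · rw [hji, Pi.mul_apply, hx', Function.update_self, Pi.mulSingle_eq_same, one_mul]
      · rw [Pi.mul_apply, hx', Function.update_of_ne hji, Pi.mulSingle_eq_of_ne hji, mul_one]
    have hx'j : ∀ j ∈ T, x' j = x j := fun j hj => by
      have hji : j ≠ i := fun h => hiT (h ▸ hj)
      rw [hx', Function.update_of_ne hji]
    obtain ⟨v, hv0, hvN, hvs⟩ := exists_chain_mul ξ (ih x' hx'T) (exists_chain_mulSingle ξ i (x i))
    rw [hxeq] at hvN
    have hsumT : ∑ j ∈ T, stdCay.dist 1 (x' j) = ∑ j ∈ T, stdCay.dist 1 (x j) := Finset.sum_congr rfl fun j hj => by rw [hx'j j hj]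
    have hsumT' : ∑ j ∈ T, (stdCay.dist 1 (x' j) : ℝ) * ∑ y ∈ ({aG, bG, cG, dG} : Finset ↥grigorchukGroup), omegaV ξ (Pi.mulSingle j y) =
        ∑ j ∈ T, (stdCay.dist 1 (x j) : ℝ) * ∑ y ∈ ({aG, bG, cG, dG} : Finset ↥grigorchukGroup), omegaV ξ (Pi.mulSingle j y) :=
      Finset.sum_congr rfl fun j hj => by rw [hx'j j hj]
    rw [hsumT] at hvN hvs
    rw [hsumT'] at hvs
    refine ⟨v, hv0, ?_, ?_⟩
    · rw [Finset.sum_insert hiT, add_comm]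
      exact hvN
    · rw [Finset.sum_insert hiT, Finset.sum_insert hiT, add_comm (stdCay.dist 1 (x i)), add_comm ((stdCay.dist 1 (x i) : ℝ) * _)]
      exact hvs

/-- **(3′) The anisotropic bound**: `ω_ξ(x) ≤ n(x) · Σ_i n_i(x) Ω_i(ξ)` with `n_i(x) = dist_𝔊(1, x_i)`, `n(x) = Σ_i n_i(x)`, `Ω_i(ξ) = Σ_{y∈{a,b,c,d}} ω_ξ(mulSingle i y)`
(chain rule «…LaceNormLemmas» `omegaV_le_mul_sum_steps` along the coordinate-by-coordinate chain).  Refuter note N-p5g35-1. [cite: HeydenreichVanDerHofstad2017, §8.3] -/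
theorem omegaV_le_aniso (ξ : GPow k →₀ ℝ) (x : GPow k) :
    omegaV ξ x ≤ (∑ i, (stdCay.dist 1 (x i) : ℝ)) *
      ∑ i, (stdCay.dist 1 (x i) : ℝ) * ∑ y ∈ ({aG, bG, cG, dG} : Finset ↥grigorchukGroup), omegaV ξ (Pi.mulSingle i y) := by
  obtain ⟨v, hv0, hvN, hvs⟩ := exists_chain_of_support ξ Finset.univ x fun i hi => absurd (Finset.mem_univ i) hi
  have h := omegaV_le_mul_sum_steps ξ v hv0 (∑ i, stdCay.dist 1 (x i))
  rw [hvN] at h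
  refine h.trans ?_
  push_cast
  exact mul_le_mul_of_nonneg_left hvs (Finset.sum_nonneg fun i _ => Nat.cast_nonneg _)

/-- `Σ_i Ω_i(ξ) = Σ_{s∈S_k} ω_ξ(s)` (the generators are the letters placed in one coordinate, injectively). [folklore] -/
theorem sum_coord_omegaV_eq (ξ : GPow k →₀ ℝ) :
    ∑ i, ∑ y ∈ ({aG, bG, cG, dG} : Finset ↥grigorchukGroup), omegaV ξ (Pi.mulSingle i y) = ∑ s ∈ gkGens k, omegaV ξ s := by
  rw [gkGens, Finset.sum_image, Finset.sum_product]
  rintro ⟨i, y⟩ hp ⟨j, y'⟩ hq h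
  obtain ⟨la, rfl⟩ : ∃ l : Letter, y = Letter.toG l := mem_gens_iff.1 (Finset.mem_product.1 (Finset.mem_coe.1 hp)).2
  obtain ⟨lb, rfl⟩ : ∃ l : Letter, y' = Letter.toG l := mem_gens_iff.1 (Finset.mem_product.1 (Finset.mem_coe.1 hq)).2
  have hinj : ((i, la) : Fin k × Letter) = (j, lb) := mulSingle_toG_injective k (a₁ := (i, la)) (a₂ := (j, lb)) h
  have h1 : i = j := congrArg Prod.fst hinj
  have h2 : la = lb := congrArg Prod.snd hinj
  subst h1 h2
  rfl

/-! ## §2 The `k`-free bound for coordinate-exchangeable kernels (4′) -/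

/-- Coordinate permutations act on `𝔊^k` by `x ↦ x ∘ σ`; the box length `n(x)` is invariant. [folklore] -/
theorem sum_dist_comp_perm (σ : Equiv.Perm (Fin k)) (x : GPow k) :
    ∑ i, (stdCay.dist 1 (x (σ i)) : ℝ) = ∑ i, (stdCay.dist 1 (x i) : ℝ) :=
  Fintype.sum_equiv σ _ _ fun _ => rfl

/-- **(4′) `Σ_x |K(x)| ω_ξ(x) ≤ 4 κ₀(ξ) · Σ_x |K(x)| n(x)²` for coordinate-EXCHANGEABLE kernels** (`K(x ∘ σ) = K(x)` for every permutation `σ` of the coordinates)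
with a summable second box moment: by (3′), `Σ_x |K| ω_ξ ≤ Σ_i Ω_i(ξ) A_i` with `A_i = Σ_x |K(x)| n(x) n_i(x)` independent of `i` (transposition `i ↔ j`), so
`A_i = k⁻¹ Σ_x |K(x)| n(x)²` and `Σ_i Ω_i = 4k κ₀` — the `k` cancels.  Refuter note N-p5g35-1. [cite: HeydenreichVanDerHofstad2017, §8.3, Prop. 8.3] -/
theorem tsum_abs_mul_omegaV_le_of_exchangeable (hk : 1 ≤ k) {K : GPow k → ℝ} (hK : ∀ σ : Equiv.Perm (Fin k), ∀ x : GPow k, K (x ∘ σ) = K x)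
    (h2 : Summable fun x => |K x| * (∑ i, (stdCay.dist 1 (x i) : ℝ)) ^ 2) (ξ : GPow k →₀ ℝ) :
    ∑' x, |K x| * omegaV ξ x ≤ 4 * kappa0 k ξ * ∑' x, |K x| * (∑ i, (stdCay.dist 1 (x i) : ℝ)) ^ 2 := by
  -- abbreviations (local, inside the proof)
  set n : GPow k → ℝ := fun x => ∑ i, (stdCay.dist 1 (x i) : ℝ) with hn
  set d : Fin k → GPow k → ℝ := fun i x => (stdCay.dist 1 (x i) : ℝ) with hd
  set Ω : Fin k → ℝ := fun i => ∑ y ∈ ({aG, bG, cG, dG} : Finset ↥grigorchukGroup), omegaV ξ (Pi.mulSingle i y) with hΩ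
  have hn0 : ∀ x, 0 ≤ n x := fun x => Finset.sum_nonneg fun i _ => Nat.cast_nonneg _
  have hd0 : ∀ i x, 0 ≤ d i x := fun i x => Nat.cast_nonneg _
  have hdn : ∀ i x, d i x ≤ n x := fun i x => Finset.single_le_sum (f := fun j => (stdCay.dist 1 (x j) : ℝ)) (fun j _ => Nat.cast_nonneg _) (Finset.mem_univ i)
  have hΩ0 : ∀ i, 0 ≤ Ω i := fun i => Finset.sum_nonneg fun y _ => omegaV_nonneg _ _
  -- the per-coordinate moments `A_i = Σ_x |K x| n(x) d_i(x)` are summable and independent of `i`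
  have hAs : ∀ i, Summable fun x => |K x| * (n x * d i x) := fun i =>
    Summable.of_nonneg_of_le (fun x => mul_nonneg (abs_nonneg _) (mul_nonneg (hn0 x) (hd0 i x)))
      (fun x => mul_le_mul_of_nonneg_left (by rw [sq]; exact mul_le_mul_of_nonneg_left (hdn i x) (hn0 x)) (abs_nonneg _)) h2
  have hAeq : ∀ i j, ∑' x, |K x| * (n x * d i x) = ∑' x, |K x| * (n x * d j x) := by
    intro i j
    set σ : Equiv.Perm (Fin k) := Equiv.swap i j with hσ
    -- reindex `x ↦ x ∘ σ` (an involution of `𝔊^k`)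
    let e : GPow k ≃ GPow k :=
      { toFun := fun x => x ∘ σ, invFun := fun x => x ∘ σ,
        left_inv := fun x => by funext m; simp [hσ, Equiv.swap_apply_self],
        right_inv := fun x => by funext m; simp [hσ, Equiv.swap_apply_self] }
    rw [← e.tsum_eq]
    refine tsum_congr fun x => ?_
    show |K (x ∘ σ)| * (n (x ∘ σ) * d i (x ∘ σ)) = |K x| * (n x * d j x)
    have hnσ : n (x ∘ σ) = n x := sum_dist_comp_perm σ x
    have hdσ : d i (x ∘ σ) = d j x := by simp only [hd, Function.comp_apply, hσ, Equiv.swap_apply_left]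
    rw [hK σ x, hnσ, hdσ]
  -- (3′) pointwise, then sum
  have hpt : ∀ x, |K x| * omegaV ξ x ≤ ∑ i, Ω i * (|K x| * (n x * d i x)) := fun x => by
    calc |K x| * omegaV ξ x ≤ |K x| * (n x * ∑ i, d i x * Ω i) := mul_le_mul_of_nonneg_left (omegaV_le_aniso ξ x) (abs_nonneg _)
      _ = ∑ i, Ω i * (|K x| * (n x * d i x)) := by rw [Finset.mul_sum, Finset.mul_sum]; exact Finset.sum_congr rfl fun i _ => by ring
  have hsR : Summable fun x => ∑ i, Ω i * (|K x| * (n x * d i x)) := summable_sum fun i _ => (hAs i).mul_left _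
  have hsL : Summable fun x => |K x| * omegaV ξ x :=
    Summable.of_nonneg_of_le (fun x => mul_nonneg (abs_nonneg _) (omegaV_nonneg ξ x)) hpt hsR
  have h1 : ∑' x, |K x| * omegaV ξ x ≤ ∑ i, Ω i * ∑' x, |K x| * (n x * d i x) := by
    refine (hsL.tsum_le_tsum hpt hsR).trans (le_of_eq ?_)
    rw [Summable.tsum_finsetSum (fun i _ => (hAs i).mul_left _)]
    exact Finset.sum_congr rfl fun i _ => tsum_mul_left
  -- all `A_i` equal `A := A_{i₀}`, and `k · A = Σ_x |K| n²`
  obtain ⟨i₀⟩ : Nonempty (Fin k) := ⟨⟨0, hk⟩⟩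
  have hA : ∀ i, ∑' x, |K x| * (n x * d i x) = ∑' x, |K x| * (n x * d i₀ x) := fun i => hAeq i i₀
  have hkA : (k : ℝ) * ∑' x, |K x| * (n x * d i₀ x) = ∑' x, |K x| * n x ^ 2 := by
    calc (k : ℝ) * ∑' x, |K x| * (n x * d i₀ x) = ∑ i : Fin k, ∑' x, |K x| * (n x * d i x) := by
          rw [Finset.sum_congr rfl fun i _ => hA i, Finset.sum_const, Finset.card_univ, Fintype.card_fin, nsmul_eq_mul]
      _ = ∑' x, ∑ i : Fin k, |K x| * (n x * d i x) := (Summable.tsum_finsetSum fun i _ => hAs i).symm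
      _ = ∑' x, |K x| * n x ^ 2 := tsum_congr fun x => by
          rw [← Finset.mul_sum, ← Finset.mul_sum, sq]
  have hΩsum : ∑ i, Ω i = 4 * k * kappa0 k ξ := by rw [hΩ, sum_coord_omegaV_eq, sum_gkGens_omegaV_eq hk]
  have hkpos : (0 : ℝ) < k := by exact_mod_cast hk
  calc ∑' x, |K x| * omegaV ξ x ≤ ∑ i, Ω i * ∑' x, |K x| * (n x * d i x) := h1
    _ = (∑ i, Ω i) * ∑' x, |K x| * (n x * d i₀ x) := by rw [Finset.sum_mul]; exact Finset.sum_congr rfl fun i _ => by rw [hA i]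
    _ = 4 * kappa0 k ξ * ((k : ℝ) * ∑' x, |K x| * (n x * d i₀ x)) := by rw [hΩsum]; ring
    _ = 4 * kappa0 k ξ * ∑' x, |K x| * n x ^ 2 := by rw [hkA]

/-- **(4′) for the lace norm: `laceNormE k K ≤ ‖K‖₁ ⊔ 4 · Σ_x |K(x)| n(x)²` for coordinate-exchangeable kernels** — no factor `k`.  Refuter note N-p5g35-1.
[cite: HeydenreichVanDerHofstad2017, Prop. 8.3] -/
theorem laceNormE_le_of_exchangeable (hk : 1 ≤ k) {K : GPow k → ℝ} (hK : ∀ σ : Equiv.Perm (Fin k), ∀ x : GPow k, K (x ∘ σ) = K x)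
    (h2 : Summable fun x => |K x| * (∑ i, (stdCay.dist 1 (x i) : ℝ)) ^ 2) :
    laceNormE k K ≤ (∑' x, ENNReal.ofReal |K x|) ⊔ ENNReal.ofReal (4 * ∑' x, |K x| * (∑ i, (stdCay.dist 1 (x i) : ℝ)) ^ 2) := by
  unfold laceNormE
  refine sup_le_sup_left (iSup₂_le fun ξ hξ => ENNReal.ofReal_le_ofReal ?_) _
  rw [div_le_iff₀ hξ]
  calc ∑' x, |K x| * omegaV ξ x ≤ 4 * kappa0 k ξ * ∑' x, |K x| * (∑ i, (stdCay.dist 1 (x i) : ℝ)) ^ 2 :=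
        tsum_abs_mul_omegaV_le_of_exchangeable hk hK h2 ξ
    _ = 4 * (∑' x, |K x| * (∑ i, (stdCay.dist 1 (x i) : ℝ)) ^ 2) * kappa0 k ξ := by ring

end NcHaraSlade

end Grigorchuk

end Summit.CriticalPhenomena.PercolationContinuityZ3.Theorems.Transplant

end
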